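import Literature.Probability.RandomPlanarGeometry.LoewnerHullHitting
import Mathlib.Topology.Semicontinuity.Basic
import HarnessLib

/-!
# The closed Loewner hull is compact and hangs from the real line

For the chordal Loewner chain of a CONTINUOUS driving function `W` (`LoewnerChain`; closed hulls
`K̂_t = closedHull W t = {z ∈ ℍ̄ : T_z ≤ t}` of `SLERestrictionLemmas`):

* `Loewner.lowerSemicontinuous_swallowingTime` — `z ↦ T_z` is lower semicontinuous
  (`isOpen_setOf_lt_swallowingTime`);
* `Loewner.isBounded_closedHull`, `Loewner.isCompact_closedHull` — `K̂_t` is compact (Lawler's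
  Lemma 4.13, `lt_swallowingTime_of_far`, which also covers the swallowed real points);
* `Loewner.isPreconnected_closedHull_union_im_nonpos` — **`K̂_t ∪ {im ≤ 0}` is connected: no
  part of the hull floats in `ℍ`.** If a compact piece `Q ⊆ K̂_t ∩ ℍ` were separated from the
  rest of `K̂_t ∪ {im ≤ 0}`, minimise the (lower semicontinuous) swallowing time over `Q`, say
  `T = σ` at `q₀`; pushing `q₀` to the frontier of `Q` inside the level set `{T = σ}` (through
  the component of `q₀` in `interior Q`, which is wholly swallowed at `σ` by
  `swallowingTime_eq_or_lt_of_isPreconnected`), one finds `q⋆ ∈ Q ∖ interior Q` with `T = σ`;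
  but a small disc about `q⋆` meets `K̂_t ∪ {im ≤ 0}` only inside `Q`, so all its points have
  `T ≥ σ`, and the same dichotomy swallows the whole disc at time `σ ≤ t` — including points
  off `K̂_t`, absurd.

The last fact is what makes `ℍ ∖ (K̂_t ∪ A)` simply connected for a hull `A` missed by `K̂_t`
(`LoewnerSlidHullStar`: the slid hulls `g_t(A) - W_t` of [LSW] §5 are `*`-hulls for every
continuous driving function). Lawler, *Conformally Invariant Processes in the Plane* (2005),
§4.1 treats `K_t` as "a compact `ℍ`-hull" throughout; the connectedness of `K̂_t ∪ ℝ` is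
implicit there.
-/

noncomputable section

open Set Filter Metric Complex
open _root_.Topology
open UpperHalfPlane (upperHalfPlaneSet isOpen_upperHalfPlaneSet)
open scoped NNReal

namespace Literature.Probability.RandomPlanarGeometry

namespace Loewner

variable {W : ℝ≥0 → ℝ}

/-! ### Semicontinuity and compactness -/

/-- **The swallowing time is lower semicontinuous** (continuous driving function). [folklore] -/
theorem lowerSemicontinuous_swallowingTime (hW : Continuous W) :
    LowerSemicontinuous (swallowingTime W) := by
  rw [lowerSemicontinuous_iff_isOpen_preimage]
  intro y
  induction y with
  | top =>
    convert isOpen_empty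
    ext z
    simp
  | coe t => exact isOpen_setOf_lt_swallowingTime hW t

/-- **The closed hull is bounded** (Lawler's Lemma 4.13: points far from the range of the
driving function on `[0, t]` are not swallowed by time `t`, real points included).
[cite: Lawler2005, Lemma 4.13] -/
theorem isBounded_closedHull (hW : Continuous W) (t : ℝ≥0) : Bornology.IsBounded (closedHull W t) := by
  obtain ⟨M, -, hM⟩ := exists_forall_norm_driving_sub_le hW t 0
  obtain ⟨δ, hδ, hδt, -⟩ := exists_delta t one_pos
  refine (isBounded_ball (x := (0 : ℂ)) (r := M + 2 * δ)).subset fun z hz ↦ ?_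
  by_contra hfar
  rw [mem_ball, dist_zero_right, not_lt] at hfar
  have h := (lt_swallowingTime_of_far (z := z) hW hM hδ hδt (by simpa using hfar)).1
  exact lt_irrefl _ (h.trans_le hz.2)

/-- **The closed hull `K̂_t` is compact.** [folklore] -/
theorem isCompact_closedHull (hW : Continuous W) (t : ℝ≥0) : IsCompact (closedHull W t) :=
  Metric.isCompact_of_isClosed_isBounded (isClosed_closedHull hW t) (isBounded_closedHull hW t)

/-! ### No part of the hull floats -/

/-- The frontier of a nonempty bounded open subset of `ℂ` is nonempty. [folklore] -/
theorem nonempty_frontier_of_isBounded {V : Set ℂ} (hVo : IsOpen V) (hne : V.Nonempty)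
    (hb : Bornology.IsBounded V) : (frontier V).Nonempty := by
  by_contra h
  rw [not_nonempty_iff_eq_empty] at h
  have hclopen : IsClopen V := by
    refine ⟨?_, hVo⟩
    have : closure V ⊆ V := by
      intro z hz
      by_contra hzV
      have : z ∈ frontier V := ⟨hz, by rwa [hVo.interior_eq]⟩
      rw [h] at this
      exact this
    exact closure_subset_iff_isClosed.1 this
  rcases isClopen_iff.1 hclopen with h0 | h1
  · exact hne.ne_empty h0
  · rw [h1] at hb
    exact (NormedSpace.unbounded_univ ℝ ℂ) hb

/-- One closed side of a closed cover of `K̂_t ∪ {im ≤ 0}` containing the lower half-plane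
contains the whole set (the core of `isPreconnected_closedHull_union_im_nonpos`). [folklore] -/
theorem closedHull_subset_of_closed_cover (hW : Continuous W) {t : ℝ≥0} {u v : Set ℂ}
    (hu : IsClosed u) (hv : IsClosed v)
    (hcover : closedHull W t ∪ {z : ℂ | z.im ≤ 0} ⊆ u ∪ v)
    (hdisj : (closedHull W t ∪ {z : ℂ | z.im ≤ 0}) ∩ (u ∩ v) = ∅)
    (hLu : {z : ℂ | z.im ≤ 0} ⊆ u) : closedHull W t ⊆ u := by
  set K := closedHull W t with hK
  set L : Set ℂ := {z : ℂ | z.im ≤ 0} with hL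
  by_contra hnot
  obtain ⟨z, hzK, hzu⟩ := not_subset.1 hnot
  -- the floating piece `Q = K ∩ v`
  set Q : Set ℂ := K ∩ v with hQ
  have hnotuv : ∀ w ∈ K ∪ L, w ∈ u → w ∈ v → False := fun w hw hwu hwv ↦ by
    have : w ∈ (K ∪ L) ∩ (u ∩ v) := ⟨hw, hwu, hwv⟩
    rw [hdisj] at this
    exact this
  have hzv : z ∈ v := ((hcover (Or.inl hzK)).resolve_left hzu)
  have hQne : Q.Nonempty := ⟨z, hzK, hzv⟩
  have hQc : IsCompact Q := (isCompact_closedHull hW t).inter_right hv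
  have hQcl : IsClosed Q := hQc.isClosed
  have hQu : ∀ q ∈ Q, q ∉ u := fun q hq hqu ↦ hnotuv q (Or.inl hq.1) hqu hq.2
  have hQH : Q ⊆ upperHalfPlaneSet := fun q hq ↦ by
    by_contra h
    have hq' : q.im ≤ 0 := not_lt.1 h
    exact hQu q hq (hLu (hq' : q ∈ L))
  -- a neighbourhood of `Q` free of `u`
  obtain ⟨δ, hδ, hthick⟩ := hQc.exists_cthickening_subset_open hu.isOpen_compl fun q hq ↦ hQu q hq
  have hnear : ∀ q ∈ Q, ∀ w, dist w q ≤ δ → w ∈ Q ∨ (0 < w.im ∧ (t : WithTop ℝ≥0) < swallowingTime W w) := by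
    intro q hq w hw
    have hwu : w ∉ u := hthick (Metric.mem_cthickening_of_dist_le w q δ Q hq hw)
    by_cases hwKL : w ∈ K ∪ L
    · left
      have hwv : w ∈ v := (hcover hwKL).resolve_left hwu
      rcases hwKL with hwK | hwL
      · exact ⟨hwK, hwv⟩
      · exact absurd (hLu hwL) hwu
    · right
      rw [mem_union, not_or] at hwKL
      have hwim : 0 < w.im := not_le.1 hwKL.2
      refine ⟨hwim, not_le.1 fun hle ↦ hwKL.1 ⟨hwim.le, hle⟩⟩
  -- minimise the swallowing time over `Q`
  obtain ⟨q₀, hq₀Q, hmin⟩ :=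
    ((lowerSemicontinuous_swallowingTime hW).lowerSemicontinuousOn Q).exists_isMinOn hQne hQc
  rw [isMinOn_iff] at hmin
  obtain ⟨σ, hσ⟩ : ∃ σ : ℝ≥0, swallowingTime W q₀ = σ := by
    have hle : swallowingTime W q₀ ≤ (t : WithTop ℝ≥0) := hq₀Q.1.2
    induction hT : swallowingTime W q₀ with
    | top => rw [hT] at hle; exact absurd hle (not_le.2 (WithTop.coe_lt_top t))
    | coe a => exact ⟨a, rfl⟩
  have hσt : σ ≤ t := by
    have : swallowingTime W q₀ ≤ (t : WithTop ℝ≥0) := hq₀Q.1.2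
    rw [hσ] at this
    exact_mod_cast this
  have hQσ : ∀ q ∈ Q, (σ : WithTop ℝ≥0) ≤ swallowingTime W q := fun q hq ↦ hσ ▸ hmin q hq
  -- the dichotomy near a point of `Q`: every point at level `σ` has a wholly swallowed disc
  have hdisc : ∀ q ∈ Q, swallowingTime W q = σ →
      ∀ w, dist w q < δ → swallowingTime W w = σ := by
    intro q hq hqσ w hw
    have hVH : ball q δ ⊆ upperHalfPlaneSet := fun w' hw' ↦ by
      rcases hnear q hq w' (le_of_lt hw') with h | h
      · exact hQH h
      · exact h.1
    have hVσ : ∀ w' ∈ ball q δ, (σ : WithTop ℝ≥0) ≤ swallowingTime W w' := fun w' hw' ↦ by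
      rcases hnear q hq w' (le_of_lt hw') with h | h
      · exact hQσ w' h
      · exact le_of_lt (lt_of_le_of_lt (by exact_mod_cast hσt) h.2)
    rcases swallowingTime_eq_or_lt_of_isPreconnected hW isOpen_ball (convex_ball q δ).isPreconnected
      hVH hVσ with hall | hall
    · exact hall w hw
    · exact absurd hqσ (ne_of_gt (hall q (mem_ball_self hδ)))
  -- a point `q⋆ ∈ Q ∖ interior Q` at level `σ`
  obtain ⟨q, hqQ, hqσ, hqint⟩ : ∃ q ∈ Q, swallowingTime W q = σ ∧ q ∉ interior Q := by
    by_cases h₀ : q₀ ∈ interior Q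
    · -- the component of `q₀` in `interior Q` is wholly swallowed at `σ`; take a frontier point
      set V : Set ℂ := connectedComponentIn (interior Q) q₀ with hV
      have hVo : IsOpen V := isOpen_interior.connectedComponentIn
      have hVsub : V ⊆ interior Q := connectedComponentIn_subset _ _
      have hVQ : V ⊆ Q := hVsub.trans interior_subset
      have hVσ' : ∀ w ∈ V, swallowingTime W w = σ := by
        have hVH : V ⊆ upperHalfPlaneSet := hVQ.trans hQH
        rcases swallowingTime_eq_or_lt_of_isPreconnected hW hVo isPreconnected_connectedComponentIn
          hVH (fun w hw ↦ hQσ w (hVQ hw)) with hall | hall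
        · exact hall
        · exact absurd hσ (ne_of_gt (hall q₀ (mem_connectedComponentIn h₀)))
      obtain ⟨p, hp⟩ := nonempty_frontier_of_isBounded hVo ⟨q₀, mem_connectedComponentIn h₀⟩
        (hQc.isBounded.subset hVQ)
      have hpQ : p ∈ Q := (closure_minimal hVQ hQcl) hp.1
      refine ⟨p, hpQ, le_antisymm ?_ (hQσ p hpQ), fun hpint ↦ ?_⟩
      · -- `{T ≤ σ}` is closed and contains `V`
        have hcl : IsClosed {w : ℂ | swallowingTime W w ≤ (σ : WithTop ℝ≥0)} :=
          isClosed_setOf_swallowingTime_le hW σ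
        exact (closure_minimal (fun w hw ↦ (hVσ' w hw).le) hcl) hp.1
      · -- a frontier point of a component of an open set is not in the open set
        have hpV : p ∉ V := fun h ↦ hp.2 (by rwa [hVo.interior_eq])
        set V' : Set ℂ := connectedComponentIn (interior Q) p with hV'
        have hV'o : IsOpen V' := isOpen_interior.connectedComponentIn
        have hpV' : p ∈ V' := mem_connectedComponentIn hpint
        obtain ⟨w, hwV', hwV⟩ : (V' ∩ V).Nonempty :=
          mem_closure_iff_nhds.1 hp.1 V' (hV'o.mem_nhds hpV')
        have : V' = V := (connectedComponentIn_eq hwV').trans (connectedComponentIn_eq hwV).symm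
        exact hpV (this ▸ hpV')
    · exact ⟨q₀, hq₀Q, hσ, h₀⟩
  -- but the disc about `q` is wholly swallowed at `σ ≤ t`, while it leaves `Q ⊇ K ∩ B(q, δ)`
  have hball : ¬ ball q δ ⊆ Q := fun h ↦ hqint (interior_mono h (by
    rw [isOpen_ball.interior_eq]; exact mem_ball_self hδ))
  obtain ⟨w, hw, hwQ⟩ := not_subset.1 hball
  rcases hnear q hqQ w (le_of_lt hw) with h | h
  · exact hwQ h
  · have h1 := hdisc q hqQ hqσ w hw
    rw [h1] at h
    exact lt_irrefl _ (lt_of_le_of_lt (by exact_mod_cast hσt : ((σ : WithTop ℝ≥0)) ≤ t) h.2)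

/-- **`K̂_t ∪ {im ≤ 0}` is connected: no part of the Loewner hull floats in `ℍ`** (continuous
driving function). [folklore] -/
theorem isPreconnected_closedHull_union_im_nonpos (hW : Continuous W) (t : ℝ≥0) :
    IsPreconnected (closedHull W t ∪ {z : ℂ | z.im ≤ 0}) := by
  set L : Set ℂ := {z : ℂ | z.im ≤ 0} with hL
  have hLc : IsPreconnected L := (convex_halfSpace_im_le (0 : ℝ)).isPreconnected
  rw [isPreconnected_iff_subset_of_disjoint_closed]
  intro u v hu hv hcover hdisj
  have hdisjL : L ∩ (u ∩ v) = ∅ := by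
    apply eq_empty_of_subset_empty
    rw [← hdisj]
    exact inter_subset_inter_left _ subset_union_right
  rcases (isPreconnected_iff_subset_of_disjoint_closed.1 hLc) u v hu hv
    (subset_union_right.trans hcover) hdisjL with hLu | hLv
  · exact Or.inl (union_subset (closedHull_subset_of_closed_cover hW hu hv hcover hdisj hLu) hLu)
  · refine Or.inr (union_subset (closedHull_subset_of_closed_cover hW hv hu ?_ ?_ hLv) hLv)
    · rwa [union_comm v u]
    · rwa [inter_comm v u]

/-- The same with the connectedness packaged (`{im ≤ 0}` is nonempty). [folklore] -/
theorem isConnected_closedHull_union_im_nonpos (hW : Continuous W) (t : ℝ≥0) :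
    IsConnected (closedHull W t ∪ {z : ℂ | z.im ≤ 0}) :=
  ⟨⟨0, Or.inr (by simp)⟩, isPreconnected_closedHull_union_im_nonpos hW t⟩

end Loewner

end Literature.Probability.RandomPlanarGeometry
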